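import Summits.CriticalPhenomena.PercolationContinuityZ3.Theses.PercNonProliferation
import Summits.CriticalPhenomena.PercolationContinuityZ3.Theses.PercAnnulusCrossing

/-!
# Sketch — first lemmas of the three crux ideas for `FreeBoxSparse` (stmt-CriticalPhenomena-4445)

crux-ideate round 1, ideator 1.  Statements only (no proofs); they must elaborate.

* `GluingCeiling`      — card `lss-bgn-gluing-ceiling`   (LSS domination + BGN, at `p_c`)
* `KissingRarity`      — card `ccfs-window-kissing-walls` (CCFS indistinguishability + L² averaging, every `p`)
* `CollarRarity`       — same card, template/thick-wall version (every `p`, every collar radius `r`)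
* `QuarantineSandwich` — card `blocking-quarantine-wiring` (annulus/inner-box independence, every `p`)
* `PolyFiniteTail`, `blocking_polyTail_freeBoxSparse` — the wiring target of that card.
-/

noncomputable section

open MeasureTheory Filter Topology
open Literature.Probability.Percolation Literature.Probability.LatticeModels
open scoped Classical

namespace Summit.CriticalPhenomena.PercolationContinuityZ3.Cruxes.FreeBoxSparse.Sketch

/-- Sites of `ℤ³`. -/
abbrev V3 : Type := Site 3

/-- The translate `Λ_n + v` of the centred box. -/
def boxAt (v : V3) (n : ℕ) : Finset V3 := (box 3 n).image (· + v)

/-- The shift `(2n+1) e₀`: `box 3 n` and `boxAt (shiftVec n) n` are adjacent, disjoint, and tile. -/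
def shiftVec (n : ℕ) : V3 := fun i => if i = 0 then 2 * (n : ℤ) + 1 else 0

/-- `#{y ∈ Λ : x ↔ y inside Λ}` — the volume of the in-box (free) cluster of `x` in `Λ`. -/
def inClusterCard (Λ : Finset V3) (ω : BondConfig V3) (x : V3) : ℕ :=
  (Λ.filter fun y => ω ∈ openConnIn (↑Λ : Set V3) x y).card

/-- `x` is `δ`-dense in `Λ`: its free cluster in `Λ` has at least `δ |Λ|` vertices. -/
def IsDense (δ : ℝ) (Λ : Finset V3) (ω : BondConfig V3) (x : V3) : Prop :=
  δ * (Λ.card : ℝ) ≤ (inClusterCard Λ ω x : ℝ)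

/-- sup-norm distance on `ℤ³`. -/
def supDist (a b : V3) : ℕ := Finset.univ.sup fun i => (a i - b i).natAbs

/-- Ordered nearest-neighbour pairs of the box. -/
def adjPairs (n : ℕ) : Finset (V3 × V3) :=
  ((box 3 n) ×ˢ (box 3 n)).filter fun q => (zdGraph 3).Adj q.1 q.2

/-- **Card `lss-bgn-gluing-ceiling`, first lemma (unconditional, at `p_c`).**
`GoodPair_n(δ)` := each of the two adjacent boxes `Λ_n`, `Λ_n + (2n+1)e₀` contains a `δ`-dense free
cluster AND every `δ`-dense free cluster of the first is joined INSIDE THE UNION to every `δ`-dense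
free cluster of the second.  Claim: `P_{p_c}(GoodPair_n(δ)) ≤ 1 - ε₀` for all `n ≥ 1`, all `δ > 0`,
with `ε₀ > 0` ABSOLUTE (the Liggett–Schonmann–Stacey constant for 1-dependent bond percolation on
the coarse half-space lattice `ℤ² × ℤ₊`): otherwise the coarse process dominates a supercritical
Bernoulli bond process, chains of dense clusters give an infinite open path inside the half-space
`{x₀ ≥ -n}`, contradicting Barsky–Grimmett–Newman (`BarskyGrimmettNewman1991_Z3_holds`). -/
def GluingCeiling : Prop :=
  ∃ ε : ℝ, 0 < ε ∧ ∀ δ : ℝ, 0 < δ → ∀ n : ℕ, 1 ≤ n →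
    (bondPercolation (zdGraph 3) (criticalProbI 3)).real
      {ω | (∃ x ∈ box 3 n, IsDense δ (box 3 n) ω x) ∧
           (∃ y ∈ boxAt (shiftVec n) n, IsDense δ (boxAt (shiftVec n) n) ω y) ∧
           ∀ x ∈ box 3 n, ∀ y ∈ boxAt (shiftVec n) n,
             IsDense δ (box 3 n) ω x → IsDense δ (boxAt (shiftVec n) n) ω y →
               ω ∈ openConnIn ((↑(box 3 n) : Set V3) ∪ ↑(boxAt (shiftVec n) n)) x y}
      ≤ 1 - ε

/-- **Card `ccfs-window-kissing-walls`, first lemma (every `p ∈ (0,1)`).**  Two DISTINCT `δ`-dense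
free clusters of `Λ_n` in contact along at least `n^{3/2+σ}` edges (ordered adjacent pairs `(a,b)`,
`a` in the cluster of `x`, `b` in the cluster of `y`; such an edge is necessarily closed) is an event
of probability `≤ C n^{-σ/2}`.  Proof route: `E_p[π_n]` (`π_n = Σ_K (|K|/|Λ_n|)²`) is increasing in
`p` and `≤ 1`; on the event, a sprinkle of density `n^{-3/2-σ}` merges the two clusters with
probability `≥ 1 - e^{-1}` and raises `π_n` by `≥ 2δ²`; summing over a grid of `n^{σ/2}` parameters
and returning to `p` by Pinsker (`d_TV(P_p, P_{p+Δ}) ≤ C Δ √(24 n³)` on the box) gives the bound.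
(Same `n^{3/2}` threshold as Aizenman–Kesten–Newman / Gandolfi–Grimmett–Russo / Cerf 2015 Lemma 5.1
with the cluster count replaced by the free volume bound `#dense ≤ 1/δ`.) -/
def KissingRarity : Prop :=
  ∀ p : unitInterval, 0 < (p : ℝ) → (p : ℝ) < 1 → ∀ δ σ : ℝ, 0 < δ → 0 < σ →
    ∃ C : ℝ, ∀ n : ℕ, 1 ≤ n →
      (bondPercolation (zdGraph 3) p).real
        {ω | ∃ x ∈ box 3 n, ∃ y ∈ box 3 n,
             IsDense δ (box 3 n) ω x ∧ IsDense δ (box 3 n) ω y ∧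
             ω ∉ openConnIn (↑(box 3 n) : Set V3) x y ∧
             (n : ℝ) ^ ((3 : ℝ) / 2 + σ) ≤
               (((adjPairs n).filter fun q =>
                   ω ∈ openConnIn (↑(box 3 n) : Set V3) x q.1 ∧
                   ω ∈ openConnIn (↑(box 3 n) : Set V3) y q.2).card : ℝ)}
        ≤ C * (n : ℝ) ^ (-(σ / 2))

/-- **Card `ccfs-window-kissing-walls`, second lemma (template / thick-wall version, every `p`).**
For every collar radius `r`: two distinct `δ`-dense free clusters of `Λ_n` which BOTH meet at least
`n^{3/2+σ}` pairwise `2r`-separated sup-norm balls of radius `r` lying inside `Λ_n` is an event of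
probability `≤ C n^{-σ/2}` (`C = C(p, δ, σ, r)`).  Same proof with the sprinkling unit "open every
edge of an `r`-ball" (an auxiliary one-parameter monotone family; Pinsker per unit costs `p^{-|E(B_r)|}`,
a constant).  Consequence: off `≤ n^{3/2+σ}` exceptional balls, distinct dense free clusters are at
mutual distance `> 2r` — walls between unglued giants have DIVERGING thickness. -/
def CollarRarity : Prop :=
  ∀ p : unitInterval, 0 < (p : ℝ) → (p : ℝ) < 1 → ∀ δ σ : ℝ, ∀ r : ℕ, 0 < δ → 0 < σ →
    ∃ C : ℝ, ∀ n : ℕ, 1 ≤ n →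
      (bondPercolation (zdGraph 3) p).real
        {ω | ∃ x ∈ box 3 n, ∃ y ∈ box 3 n,
             IsDense δ (box 3 n) ω x ∧ IsDense δ (box 3 n) ω y ∧
             ω ∉ openConnIn (↑(box 3 n) : Set V3) x y ∧
             ∃ S : Finset V3, (∀ a ∈ S, boxAt a r ⊆ box 3 n) ∧
               (n : ℝ) ^ ((3 : ℝ) / 2 + σ) ≤ (S.card : ℝ) ∧
               (∀ a ∈ S, ∀ b ∈ S, a ≠ b → 2 * r < supDist a b) ∧
               ∀ a ∈ S, (∃ u ∈ box 3 n, supDist u a ≤ r ∧ ω ∈ openConnIn (↑(box 3 n) : Set V3) x u) ∧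
                        (∃ v ∈ box 3 n, supDist v a ≤ r ∧ ω ∈ openConnIn (↑(box 3 n) : Set V3) y v)}
        ≤ C * (n : ℝ) ^ (-(σ / 2))

/-- The annulus-blocking probability `u_n(p) = P_p(¬ B(n) ↔ ∂⁻B(2n) inside B(2n))` — the quantity of
the sibling crux `SubpolynomialBlocking` (stmt-4446). -/
def blockingProb (p : unitInterval) (n : ℕ) : ℝ :=
  (bondPercolation (zdGraph 3) p).real
    {ω | ¬ ∃ x ∈ box 3 n, ∃ y ∈ innerBoundary (zdGraph 3) (box 3 (2 * n)),
        ω ∈ openConnIn (↑(box 3 (2 * n)) : Set V3) x y}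

/-- **Card `blocking-quarantine-wiring`, first lemma (every `p`).**  The blocking event is measurable
with respect to the edges of `B(2n)` NOT inside `B(n)` (trim a crossing path at its last visit to
`B(n)`), hence independent of the free cluster of `x` inside `B(n)`; on the intersection `C(x)` is
finite (confined to `B(2n)`) and has `≥ m` vertices.  So `u_n · P(|K_{B(n)}(x)| ≥ m) ≤ P(m ≤ |C(x)| < ∞)`. -/
def QuarantineSandwich : Prop :=
  ∀ p : unitInterval, ∀ n m : ℕ, 1 ≤ n → ∀ x ∈ box 3 n,
    blockingProb p n *
        (bondPercolation (zdGraph 3) p).real {ω | m ≤ inClusterCard (box 3 n) ω x}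
      ≤ (bondPercolation (zdGraph 3) p).real
          {ω | (m : ℕ∞) ≤ (openCluster ω x).encard ∧ (openCluster ω x).Finite}

/-- Polynomial tail of FINITE critical clusters: `P_{p_c}(m ≤ |C(0)| < ∞) ≤ C m^{-κ}` for some `κ > 0`
(healthy world: `κ = 1/δ_vol ≈ 0.19`; open in `d = 3`; in a jump world it concerns the finite
clusters coexisting with the infinite one). -/
def PolyFiniteTail : Prop :=
  ∃ κ C : ℝ, 0 < κ ∧ ∀ m : ℕ, 1 ≤ m →
    (bondPercolation (zdGraph 3) (criticalProbI 3)).real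
        {ω | (m : ℕ∞) ≤ (openCluster ω (0 : V3)).encard ∧ (openCluster ω (0 : V3)).Finite}
      ≤ C * (m : ℝ) ^ (-κ)

/-- **The wiring** (provable now from `QuarantineSandwich`, translation invariance and
`FA₂(n) ≤ δ + |Λ_n|⁻¹ Σ_x P(|K_{Λ_n}(x)| ≥ δ|Λ_n|)`): the route's own crux r4 plus a polynomial
finite-cluster tail give r3. -/
def blocking_polyTail_freeBoxSparse : Prop :=
  Theses.PercNonProliferation.SubpolynomialBlocking → PolyFiniteTail →
    Theses.PercNonProliferation.FreeBoxSparse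

/-- **The second wiring** (provable now from `QuarantineSandwich` and `P(m ≤ |C| < ∞) → 0`): the
uniform blocking bound `X_B` of route PercAnnulusCrossing (stmt-0846) already implies r3. -/
def annulusNonCrossing_freeBoxSparse : Prop :=
  Theses.PercAnnulusCrossing.CritAnnulusNonCrossing → Theses.PercNonProliferation.FreeBoxSparse

end Summit.CriticalPhenomena.PercolationContinuityZ3.Cruxes.FreeBoxSparse.Sketch

end
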